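import Mathlib
import HarnessLib
import Summits.Ventures.LatticeQCDFlow.Exactness.SUNJitteredHMCCertificates
import Summits.Ventures.LatticeQCDFlow.Exactness.SUNMetropolisORSweepFiguresOfMerit
import Summits.Ventures.LatticeQCDFlow.Exactness.CabibboMarinariORSweepFiguresOfMerit
import Summits.Ventures.LatticeQCDFlow.Exactness.SUNLeapfrogHMCORSweepFiguresOfMerit
import Summits.Ventures.LatticeQCDFlow.Scoring.BatchMeansTauIntCLT
import Summits.Ventures.LatticeQCDFlow.Scoring.AsymptoticCoverage
import Summits.Ventures.LatticeQCDFlow.Scoring.DoeblinPowerGeometricEnvelope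

/-!
# Error bars ON the reported `τ_int` for the engine's chains as run (GEN-23, row 9 eng-latcore, 23-20)

NEW WORK of the cell, not a published result; no definition is introduced; nothing is cited as a fact.
HONEST FRAMING: exact (Metropolis-corrected) sampling algorithms for lattice gauge theory; figures of merit are
autocorrelation/cost numbers at stated couplings and volumes; no continuum-physics claim.

The cell's figure of merit `τ_int` is REPORTED with an error bar.  For the batch-means estimate `τ̂ = σ̂²_BM/(2 v̂)`
(`a` batches of length `b`, `v̂` the sample variance) row 4's `Scoring/BatchMeansTauIntCLT` proves, under a geometric
envelope, from ANY start, for `a_n, b_n → ∞` with `a_n/b_n² → 0`, `Var_π f ≠ 0`, `σ²_f > 0`: the studentisation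
`√a_n (τ̂_n − τ_int)/(√2 τ̂_n) ⇒ N(0, 1)` — THE RELATIVE STANDARD ERROR OF `τ̂_int` IS `√(2/a)` and the interval
`τ̂ (1 ± z √(2/a))` is an asymptotically exact confidence interval for `τ_int`.

THIS FILE turns that into the coverage statement `P_{μ₀}(|√a_n (τ̂_n − τ_int)/(√2 τ̂_n)| ≤ z) → N(0,1)([−z, z])` for
the engine's certified chains AS RUN on `SU(N)` (any `β`; `L ≥ 2` where a sweep is involved), the envelope being
supplied from the GEN-23 Doeblin certificate by row 8's `Scoring.exists_geometricEnvelope_of_nHit` and the passage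
from the CLT to the probability of `[−z, z]` by row 11's `Scoring.CardConsistency.tendsto_measureReal_abs_le_gaussian`:

* §1 jittered `'hmc'` with one short atom: **`wilsonJitterHMC_tauInt_interval_coverage`**;
* §2 jittered `'hmc'` + ANY exact step: **`wilsonJitterHMC_exactStep_tauInt_interval_coverage`**;
* §3 DEFAULT fixed-step `'hmc'` + ANY exact step: **`wilson_sunLeapfrogHMCN_exactStep_tauInt_interval_coverage`**;
* §4 `'metro' + n_or × 'or'`: **`wilson_sunMetropolis_orSweep_tauInt_interval_coverage`**;
* §5 CM `'hb' + n_or × 'or'`: **`wilson_cmSweep_orSweep_tauInt_interval_coverage`**.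

(The same statement for row 4's generic chain is `Scoring/BatchMeansTauIntCoverage.chain_batchMeans_tauInt_coverage_of_nHit`;
it is re-derived here in three lines per chain rather than imported, its module having no build yet.)

NOT CLAIMED: `Var_π f = 0` or `σ²_f = 0`; the regime `a_n/b_n² ↛ 0`; the Γ-method's error formula; any value.
-/

noncomputable section

namespace Summit.Ventures.LatticeQCDFlow.Exactness

open MeasureTheory ProbabilityTheory ProbabilityTheory.Kernel Set Function Filter Topology
open Literature.MathematicalPhysics.QuantumFieldTheory
open Literature.MathematicalPhysics.QuantumLattice (fundamentalRep continuous_fundamentalRep connectedSpace_specialUnitaryGroup)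
open Summit.Ventures.LatticeQCDFlow.Scoring (replicaSEsq tauInt autocov kop)
open scoped ENNReal Matrix Matrix.Norms.Operator NNReal

/-! ## §1 The jittered `'hmc'` path with one short atom -/

section Jittered

variable {N d L : ℕ} [NeZero N] [NeZero L] (β : ℝ)
variable {Lab : Type*} [Countable Lab] [MeasurableSpace Lab] [MeasurableSingletonClass Lab]

/-- **`τ̂ (1 ± z √(2/a))` COVERS `τ_int` WITH PROBABILITY `→ N(0,1)([−z, z])` — JITTERED ENGINE HMC, EVERY START.**
There is `τ₀ > 0` (depending on `N, d, L, β` only) such that whenever one atom `l₀` of the jitter law has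
`1 ≤ nstep l₀`, `η {l₀} ≠ 0`, `0 < τ l₀ ≤ τ₀`: for `|f| ≤ C` measurable with `Var_π f ≠ 0` and `σ²_f > 0`, every
initial law `μ₀`, all `a_n, b_n → ∞` with `a_n/b_n² → 0` and every `z`,
`P_{μ₀}(|√a_n (τ̂_n − τ_int)| ≤ z √2 τ̂_n) → N(0,1)([−z, z])`. -/
theorem wilsonJitterHMC_tauInt_interval_coverage :
    ∃ τ₀ : ℝ, 0 < τ₀ ∧ ∀ (nstep : Lab → ℕ) (τ : Lab → ℝ) (η : Measure Lab) [IsProbabilityMeasure η] (l₀ : Lab),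
      1 ≤ nstep l₀ → η {l₀} ≠ 0 → 0 < τ l₀ → τ l₀ ≤ τ₀ →
      ∀ (f : GaugeConfig d L (Matrix.specialUnitaryGroup (Fin N) ℂ) → ℝ), Measurable f → ∀ C : ℝ, (∀ U, |f U| ≤ C) →
        autocov (wilsonJitterHMC N d L β nstep τ η)
              (wilsonMeasure (d := d) (L := L) (fundamentalRep (Fin N)) (β / N))
              (fun y => f y - ∫ z, f z ∂(wilsonMeasure (d := d) (L := L) (fundamentalRep (Fin N)) (β / N))) 0 ≠ 0 →
        0 < ((∫ y, (f y - ∫ z, f z ∂(wilsonMeasure (d := d) (L := L) (fundamentalRep (Fin N)) (β / N))) ^ 2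
              ∂(wilsonMeasure (d := d) (L := L) (fundamentalRep (Fin N)) (β / N)))
          + 2 * ∑' k, ∫ y, (f y - ∫ z, f z ∂(wilsonMeasure (d := d) (L := L) (fundamentalRep (Fin N)) (β / N)))
            * (kop (wilsonJitterHMC N d L β nstep τ η))^[k + 1]
              (fun y => f y - ∫ z, f z ∂(wilsonMeasure (d := d) (L := L) (fundamentalRep (Fin N)) (β / N))) y
                ∂(wilsonMeasure (d := d) (L := L) (fundamentalRep (Fin N)) (β / N))) →
      ∀ (μ₀ : Measure (GaugeConfig d L (Matrix.specialUnitaryGroup (Fin N) ℂ))) [IsProbabilityMeasure μ₀] (a b : ℕ → ℕ),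
        Tendsto a atTop atTop → Tendsto b atTop atTop → Tendsto (fun n => (a n : ℝ) / (b n : ℝ) ^ 2) atTop (𝓝 0) →
      ∀ [IsProbabilityMeasure (Kernel.trajMeasure (X := fun _ : ℕ => GaugeConfig d L (Matrix.specialUnitaryGroup (Fin N) ℂ)) μ₀
          (fun n : ℕ => (wilsonJitterHMC N d L β nstep τ η).comap
              (fun h' : (i : ↥(Finset.Iic n))
                → GaugeConfig d L (Matrix.specialUnitaryGroup (Fin N) ℂ) => h' ⟨n, Finset.mem_Iic.2 le_rfl⟩)
            (measurable_pi_apply _)))] (z : ℝ),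
        Tendsto (fun n : ℕ => ((Kernel.trajMeasure (X := fun _ : ℕ => GaugeConfig d L (Matrix.specialUnitaryGroup (Fin N) ℂ)) μ₀
              (fun n : ℕ => (wilsonJitterHMC N d L β nstep τ η).comap
              (fun h' : (i : ↥(Finset.Iic n))
                → GaugeConfig d L (Matrix.specialUnitaryGroup (Fin N) ℂ) => h' ⟨n, Finset.mem_Iic.2
                    le_rfl⟩)
                (measurable_pi_apply _)))).real
          {x | |Real.sqrt (a n) * ((((b n * a n : ℕ) : ℝ) * replicaSEsq
              (fun j (x : ℕ → GaugeConfig d L (Matrix.specialUnitaryGroup (Fin N) ℂ)) => (∑ i ∈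
                Finset.range (b n), f (x (b n * j + i))) / (b n)) (a n) x) / (2 * ((∑ t ∈ Finset.range
                (b n * a n), f (x t) ^ 2) / ((b n * a n : ℕ) : ℝ) - ((∑ t ∈ Finset.range (b n * a n), f
                (x t)) / ((b n * a n : ℕ) : ℝ)) ^ 2))
              - tauInt (fun t => autocov (wilsonJitterHMC N d L β nstep τ η)
              (wilsonMeasure (d := d) (L := L) (fundamentalRep (Fin N)) (β / N))
              (fun y => f y - ∫ z, f z ∂(wilsonMeasure (d := d) (L := L) (fundamentalRep (Fin N)) (β / N))) t
                  / autocov (wilsonJitterHMC N d L β nstep τ η)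
              (wilsonMeasure (d := d) (L := L) (fundamentalRep (Fin N)) (β / N))
              (fun y => f y - ∫ z, f z ∂(wilsonMeasure (d := d) (L := L) (fundamentalRep (Fin N)) (β / N))) 0))
            / (Real.sqrt 2 * ((((b n * a n : ℕ) : ℝ) * replicaSEsq
              (fun j (x : ℕ → GaugeConfig d L (Matrix.specialUnitaryGroup (Fin N) ℂ)) => (∑ i ∈
                  Finset.range (b n), f (x (b n * j + i))) / (b n)) (a n) x) / (2 * ((∑ t ∈
                  Finset.range (b n * a n), f (x t) ^ 2) / ((b n * a n : ℕ) : ℝ) - ((∑ t ∈ Finset.range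
                  (b n * a n), f (x t)) / ((b n * a n : ℕ) : ℝ)) ^ 2))))| ≤ z})
          atTop (𝓝 ((gaussianReal 0 1).real (Set.Icc (-z) z))) := by
  obtain ⟨τ₀, hτ₀, h⟩ := wilsonJitterHMC_certificate (N := N) (d := d) (L := L) (Lab := Lab) β
  refine ⟨τ₀, hτ₀, fun nstep τ η _ l₀ hn hl₀ hτl hτl₀ f hf C hC hvar hσ μ₀ _ a b ha hb hab _ z => ?_⟩
  obtain ⟨m, ε', hm, hε0, hε1, hmin⟩ := h nstep τ η l₀ hn hl₀ hτl hτl₀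
  obtain ⟨A, ρ, hA, hρ0, hρ1, henv⟩ := Scoring.exists_geometricEnvelope_of_nHit (GeneralNCMC.minorised_setwise hmin)
    hε0 hε1 hm (wilsonJitterHMC_invariant (N := N) (d := d) (L := L) β nstep τ η)
  have hY : HasLaw (fun t : ℝ => t) (gaussianReal 0 1) (gaussianReal 0 1) := ⟨aemeasurable_id', Measure.map_id'⟩
  exact Scoring.CardConsistency.tendsto_measureReal_abs_le_gaussian
    (Scoring.chain_batchMeans_tauInt_studentized_clt_of_envelope
      (wilsonJitterHMC_invariant (N := N) (d := d) (L := L) β nstep τ η) henv hA hρ0 hρ1 hf hC hvar hσ μ₀ ha hb hab hY)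
    hY z

/-! ## §2 The jittered `'hmc'` path followed by ANY exact step -/

/-- **THE SAME FOR THE COMPOSITE `P ∘ K_jit`** — `P` ANY Markov kernel leaving `wilsonMeasure (β/N)` invariant. -/
theorem wilsonJitterHMC_exactStep_tauInt_interval_coverage :
    ∃ τ₀ : ℝ, 0 < τ₀ ∧ ∀ (nstep : Lab → ℕ) (τ : Lab → ℝ) (η : Measure Lab) [IsProbabilityMeasure η] (l₀ : Lab),
      1 ≤ nstep l₀ → η {l₀} ≠ 0 → 0 < τ l₀ → τ l₀ ≤ τ₀ →
      ∀ (P : Kernel (GaugeConfig d L (Matrix.specialUnitaryGroup (Fin N) ℂ)) (GaugeConfig d L (Matrix.specialUnitaryGroup (Fin N) ℂ)))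
        [IsMarkovKernel P], Invariant P (wilsonMeasure (d := d) (L := L) (fundamentalRep (Fin N)) (β / N)) →
      ∀ (f : GaugeConfig d L (Matrix.specialUnitaryGroup (Fin N) ℂ) → ℝ), Measurable f → ∀ C : ℝ, (∀ U, |f U| ≤ C) →
        autocov (P ∘ₖ wilsonJitterHMC N d L β nstep τ η)
              (wilsonMeasure (d := d) (L := L) (fundamentalRep (Fin N)) (β / N))
              (fun y => f y - ∫ z, f z ∂(wilsonMeasure (d := d) (L := L) (fundamentalRep (Fin N)) (β / N))) 0 ≠ 0 →
        0 < ((∫ y, (f y - ∫ z, f z ∂(wilsonMeasure (d := d) (L := L) (fundamentalRep (Fin N)) (β / N))) ^ 2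
              ∂(wilsonMeasure (d := d) (L := L) (fundamentalRep (Fin N)) (β / N)))
          + 2 * ∑' k, ∫ y, (f y - ∫ z, f z ∂(wilsonMeasure (d := d) (L := L) (fundamentalRep (Fin N)) (β / N)))
            * (kop (P ∘ₖ wilsonJitterHMC N d L β nstep τ η))^[k + 1]
              (fun y => f y - ∫ z, f z ∂(wilsonMeasure (d := d) (L := L) (fundamentalRep (Fin N)) (β / N))) y
                ∂(wilsonMeasure (d := d) (L := L) (fundamentalRep (Fin N)) (β / N))) →
      ∀ (μ₀ : Measure (GaugeConfig d L (Matrix.specialUnitaryGroup (Fin N) ℂ))) [IsProbabilityMeasure μ₀] (a b : ℕ → ℕ),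
        Tendsto a atTop atTop → Tendsto b atTop atTop → Tendsto (fun n => (a n : ℝ) / (b n : ℝ) ^ 2) atTop (𝓝 0) →
      ∀ [IsProbabilityMeasure (Kernel.trajMeasure (X := fun _ : ℕ => GaugeConfig d L (Matrix.specialUnitaryGroup (Fin N) ℂ)) μ₀
          (fun n : ℕ => (P ∘ₖ wilsonJitterHMC N d L β nstep τ η).comap
              (fun h' : (i : ↥(Finset.Iic n))
                → GaugeConfig d L (Matrix.specialUnitaryGroup (Fin N) ℂ) => h' ⟨n, Finset.mem_Iic.2 le_rfl⟩)
            (measurable_pi_apply _)))] (z : ℝ),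
        Tendsto (fun n : ℕ => ((Kernel.trajMeasure (X := fun _ : ℕ => GaugeConfig d L (Matrix.specialUnitaryGroup (Fin N) ℂ)) μ₀
              (fun n : ℕ => (P ∘ₖ wilsonJitterHMC N d L β nstep τ η).comap
              (fun h' : (i : ↥(Finset.Iic n))
                → GaugeConfig d L (Matrix.specialUnitaryGroup (Fin N) ℂ) => h' ⟨n, Finset.mem_Iic.2
                    le_rfl⟩)
                (measurable_pi_apply _)))).real
          {x | |Real.sqrt (a n) * ((((b n * a n : ℕ) : ℝ) * replicaSEsq
              (fun j (x : ℕ → GaugeConfig d L (Matrix.specialUnitaryGroup (Fin N) ℂ)) => (∑ i ∈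
                Finset.range (b n), f (x (b n * j + i))) / (b n)) (a n) x) / (2 * ((∑ t ∈ Finset.range
                (b n * a n), f (x t) ^ 2) / ((b n * a n : ℕ) : ℝ) - ((∑ t ∈ Finset.range (b n * a n), f
                (x t)) / ((b n * a n : ℕ) : ℝ)) ^ 2))
              - tauInt (fun t => autocov (P ∘ₖ wilsonJitterHMC N d L β nstep τ η)
              (wilsonMeasure (d := d) (L := L) (fundamentalRep (Fin N)) (β / N))
              (fun y => f y - ∫ z, f z ∂(wilsonMeasure (d := d) (L := L) (fundamentalRep (Fin N)) (β / N))) t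
                  / autocov (P ∘ₖ wilsonJitterHMC N d L β nstep τ η)
              (wilsonMeasure (d := d) (L := L) (fundamentalRep (Fin N)) (β / N))
              (fun y => f y - ∫ z, f z ∂(wilsonMeasure (d := d) (L := L) (fundamentalRep (Fin N)) (β / N))) 0))
            / (Real.sqrt 2 * ((((b n * a n : ℕ) : ℝ) * replicaSEsq
              (fun j (x : ℕ → GaugeConfig d L (Matrix.specialUnitaryGroup (Fin N) ℂ)) => (∑ i ∈
                  Finset.range (b n), f (x (b n * j + i))) / (b n)) (a n) x) / (2 * ((∑ t ∈
                  Finset.range (b n * a n), f (x t) ^ 2) / ((b n * a n : ℕ) : ℝ) - ((∑ t ∈ Finset.range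
                  (b n * a n), f (x t)) / ((b n * a n : ℕ) : ℝ)) ^ 2))))| ≤ z})
          atTop (𝓝 ((gaussianReal 0 1).real (Set.Icc (-z) z))) := by
  obtain ⟨τ₀, hτ₀, h⟩ := wilsonJitterHMC_exactStep_certificate (N := N) (d := d) (L := L) (Lab := Lab) β
  refine ⟨τ₀, hτ₀, fun nstep τ η _ l₀ hn hl₀ hτl hτl₀ P _ hP f hf C hC hvar hσ μ₀ _ a b ha hb hab _ z => ?_⟩
  obtain ⟨hinv, m, ε', hm, hε0, hε1, hmin⟩ := h nstep τ η l₀ hn hl₀ hτl hτl₀ P hP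
  haveI := isMarkovKernel_wilsonJitterHMC (N := N) (d := d) (L := L) β nstep τ η
  obtain ⟨A, ρ, hA, hρ0, hρ1, henv⟩ := Scoring.exists_geometricEnvelope_of_nHit (GeneralNCMC.minorised_setwise hmin)
    hε0 hε1 hm hinv
  have hY : HasLaw (fun t : ℝ => t) (gaussianReal 0 1) (gaussianReal 0 1) := ⟨aemeasurable_id', Measure.map_id'⟩
  exact Scoring.CardConsistency.tendsto_measureReal_abs_le_gaussian
    (Scoring.chain_batchMeans_tauInt_studentized_clt_of_envelope hinv henv hA hρ0 hρ1 hf hC hvar hσ μ₀ ha hb hab hY) hY z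

end Jittered

/-! ## §3 The DEFAULT fixed-step `'hmc'` followed by ANY exact step -/

section FixedStep

variable (N : ℕ) [NeZero N] {d L : ℕ} [NeZero L] (β : ℝ)

/-- **THE SAME FOR `P ∘ K_hmc` (FIXED STEP, `nstep · ε ≤ τ₀`)** — `P` ANY exact step. -/
theorem wilson_sunLeapfrogHMCN_exactStep_tauInt_interval_coverage :
    ∃ τ₀ : ℝ, 0 < τ₀ ∧ ∀ (nstep : ℕ) (ε : ℝ), 1 ≤ nstep → 0 < ε → nstep * ε ≤ τ₀ →
      ∀ (P : Kernel (GaugeConfig d L (Matrix.specialUnitaryGroup (Fin N) ℂ)) (GaugeConfig d L (Matrix.specialUnitaryGroup (Fin N) ℂ)))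
        [IsMarkovKernel P], Invariant P (wilsonMeasure (d := d) (L := L) (fundamentalRep (Fin N)) (β / N)) →
      ∀ [IsMarkovKernel (sunLeapfrogHMCN (sunCoordι N) (sunCoordι_skew N) ε (Measure.addHaar : Measure (SUNCoords N))
                  (sunKinetic N) (measurable_halfKick_sun N (measurable_sunWilsonForceLaw_coeConfig N (d := d) (L := L) β) ε)
                  (fun U => β / N * wilsonAction (fundamentalRep (Fin N)) U) nstep)],
      ∀ (f : GaugeConfig d L (Matrix.specialUnitaryGroup (Fin N) ℂ) → ℝ), Measurable f → ∀ C : ℝ, (∀ U, |f U| ≤ C) →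
        autocov (P ∘ₖ (sunLeapfrogHMCN (sunCoordι N) (sunCoordι_skew N) ε (Measure.addHaar : Measure (SUNCoords N))
                  (sunKinetic N) (measurable_halfKick_sun N (measurable_sunWilsonForceLaw_coeConfig N (d := d) (L := L) β) ε)
                  (fun U => β / N * wilsonAction (fundamentalRep (Fin N)) U) nstep))
              (wilsonMeasure (d := d) (L := L) (fundamentalRep (Fin N)) (β / N))
              (fun y => f y - ∫ z, f z ∂(wilsonMeasure (d := d) (L := L) (fundamentalRep (Fin N)) (β / N))) 0 ≠ 0 →
        0 < ((∫ y, (f y - ∫ z, f z ∂(wilsonMeasure (d := d) (L := L) (fundamentalRep (Fin N)) (β / N))) ^ 2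
              ∂(wilsonMeasure (d := d) (L := L) (fundamentalRep (Fin N)) (β / N)))
          + 2 * ∑' k, ∫ y, (f y - ∫ z, f z ∂(wilsonMeasure (d := d) (L := L) (fundamentalRep (Fin N)) (β / N)))
            * (kop (P ∘ₖ (sunLeapfrogHMCN (sunCoordι N) (sunCoordι_skew N) ε (Measure.addHaar : Measure (SUNCoords N))
                  (sunKinetic N) (measurable_halfKick_sun N (measurable_sunWilsonForceLaw_coeConfig N (d := d) (L := L) β) ε)
                  (fun U => β / N * wilsonAction (fundamentalRep (Fin N)) U) nstep)))^[k + 1]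
              (fun y => f y - ∫ z, f z ∂(wilsonMeasure (d := d) (L := L) (fundamentalRep (Fin N)) (β / N))) y
                ∂(wilsonMeasure (d := d) (L := L) (fundamentalRep (Fin N)) (β / N))) →
      ∀ (μ₀ : Measure (GaugeConfig d L (Matrix.specialUnitaryGroup (Fin N) ℂ))) [IsProbabilityMeasure μ₀] (a b : ℕ → ℕ),
        Tendsto a atTop atTop → Tendsto b atTop atTop → Tendsto (fun n => (a n : ℝ) / (b n : ℝ) ^ 2) atTop (𝓝 0) →
      ∀ [IsProbabilityMeasure (Kernel.trajMeasure (X := fun _ : ℕ => GaugeConfig d L (Matrix.specialUnitaryGroup (Fin N) ℂ)) μ₀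
          (fun n : ℕ => (P ∘ₖ (sunLeapfrogHMCN (sunCoordι N) (sunCoordι_skew N) ε (Measure.addHaar : Measure (SUNCoords N))
                  (sunKinetic N) (measurable_halfKick_sun N (measurable_sunWilsonForceLaw_coeConfig N (d := d) (L := L) β) ε)
                  (fun U => β / N * wilsonAction (fundamentalRep (Fin N)) U) nstep)).comap
              (fun h' : (i : ↥(Finset.Iic n))
                → GaugeConfig d L (Matrix.specialUnitaryGroup (Fin N) ℂ) => h' ⟨n, Finset.mem_Iic.2 le_rfl⟩)
            (measurable_pi_apply _)))] (z : ℝ),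
        Tendsto (fun n : ℕ => ((Kernel.trajMeasure (X := fun _ : ℕ => GaugeConfig d L (Matrix.specialUnitaryGroup (Fin N) ℂ)) μ₀
              (fun n : ℕ => (P ∘ₖ (sunLeapfrogHMCN (sunCoordι N) (sunCoordι_skew N) ε (Measure.addHaar : Measure (SUNCoords N))
                      (sunKinetic N) (measurable_halfKick_sun N (measurable_sunWilsonForceLaw_coeConfig N (d := d) (L := L) β) ε)
                      (fun U => β / N * wilsonAction (fundamentalRep (Fin N)) U) nstep)).comap
              (fun h' : (i : ↥(Finset.Iic n))
                → GaugeConfig d L (Matrix.specialUnitaryGroup (Fin N) ℂ) => h' ⟨n, Finset.mem_Iic.2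
                    le_rfl⟩)
                (measurable_pi_apply _)))).real
          {x | |Real.sqrt (a n) * ((((b n * a n : ℕ) : ℝ) * replicaSEsq
              (fun j (x : ℕ → GaugeConfig d L (Matrix.specialUnitaryGroup (Fin N) ℂ)) => (∑ i ∈
                Finset.range (b n), f (x (b n * j + i))) / (b n)) (a n) x) / (2 * ((∑ t ∈ Finset.range
                (b n * a n), f (x t) ^ 2) / ((b n * a n : ℕ) : ℝ) - ((∑ t ∈ Finset.range (b n * a n), f
                (x t)) / ((b n * a n : ℕ) : ℝ)) ^ 2))
              - tauInt (fun t => autocov (P ∘ₖ (sunLeapfrogHMCN (sunCoordι N) (sunCoordι_skew N) ε (Measure.addHaar : Measure (SUNCoords N))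
                      (sunKinetic N) (measurable_halfKick_sun N (measurable_sunWilsonForceLaw_coeConfig N (d := d) (L := L) β) ε)
                      (fun U => β / N * wilsonAction (fundamentalRep (Fin N)) U) nstep))
              (wilsonMeasure (d := d) (L := L) (fundamentalRep (Fin N)) (β / N))
              (fun y => f y - ∫ z, f z ∂(wilsonMeasure (d := d) (L := L) (fundamentalRep (Fin N)) (β / N))) t
                  / autocov (P ∘ₖ (sunLeapfrogHMCN (sunCoordι N) (sunCoordι_skew N) ε (Measure.addHaar : Measure (SUNCoords N))
                      (sunKinetic N) (measurable_halfKick_sun N (measurable_sunWilsonForceLaw_coeConfig N (d := d) (L := L) β) ε)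
                      (fun U => β / N * wilsonAction (fundamentalRep (Fin N)) U) nstep))
              (wilsonMeasure (d := d) (L := L) (fundamentalRep (Fin N)) (β / N))
              (fun y => f y - ∫ z, f z ∂(wilsonMeasure (d := d) (L := L) (fundamentalRep (Fin N)) (β / N))) 0))
            / (Real.sqrt 2 * ((((b n * a n : ℕ) : ℝ) * replicaSEsq
              (fun j (x : ℕ → GaugeConfig d L (Matrix.specialUnitaryGroup (Fin N) ℂ)) => (∑ i ∈
                  Finset.range (b n), f (x (b n * j + i))) / (b n)) (a n) x) / (2 * ((∑ t ∈
                  Finset.range (b n * a n), f (x t) ^ 2) / ((b n * a n : ℕ) : ℝ) - ((∑ t ∈ Finset.range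
                  (b n * a n), f (x t)) / ((b n * a n : ℕ) : ℝ)) ^ 2))))| ≤ z})
          atTop (𝓝 ((gaussianReal 0 1).real (Set.Icc (-z) z))) := by
  obtain ⟨τ₀, hτ₀, h⟩ := wilson_sunLeapfrogHMCN_exactStep_certificate N (d := d) (L := L) β
  refine ⟨τ₀, hτ₀, fun nstep ε hn hε hτ P _ hP _ f hf C hC hvar hσ μ₀ _ a b ha hb hab _ z => ?_⟩
  obtain ⟨hinv, m, ε', hm, hε0, hε1, hmin⟩ := h nstep ε hn hε hτ P hP
  obtain ⟨A, ρ, hA, hρ0, hρ1, henv⟩ := Scoring.exists_geometricEnvelope_of_nHit (GeneralNCMC.minorised_setwise hmin)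
    hε0 hε1 hm hinv
  have hY : HasLaw (fun t : ℝ => t) (gaussianReal 0 1) (gaussianReal 0 1) := ⟨aemeasurable_id', Measure.map_id'⟩
  exact Scoring.CardConsistency.tendsto_measureReal_abs_le_gaussian
    (Scoring.chain_batchMeans_tauInt_studentized_clt_of_envelope hinv henv hA hρ0 hρ1 hf hC hvar hσ μ₀ ha hb hab hY) hY z

end FixedStep

/-! ## §4 `'metro' + n_or × 'or'` -/

section MetroOR

variable (N : ℕ) (s : ℝ) [Fact (0 < s)] [NeZero N]
variable {d L : ℕ} {m : Type*} [Fintype m] [DecidableEq m]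

/-- **THE SAME FOR `'metro' + n_or × 'or'`** (`L ≥ 2`, `nhit ≥ 1`, the link list visits every link, any OR schedule). -/
theorem wilson_sunMetropolis_orSweep_tauInt_interval_coverage [NeZero L] (hL : 2 ≤ L) (β : ℝ) {nhit : ℕ} (hn : 1 ≤ nhit)
    {Ls : List (Edge d L)} (hLs : ∀ e, e ∈ Ls) (sched : List (Edge d L × (Fin N ≃ Fin 2 ⊕ m)))
    [IsMarkovKernel (metropolisSweep (sunMetropolisKick N s)
                (fun U : GaugeConfig d L (Matrix.specialUnitaryGroup (Fin N) ℂ) => Real.exp (-β * wilsonAction (suRep N) U)) nhit Ls)]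
    {f : GaugeConfig d L (Matrix.specialUnitaryGroup (Fin N) ℂ) → ℝ} (hf : Measurable f) {C : ℝ} (hC : ∀ U, |f U| ≤ C)
    (hvar : autocov (cmORSweep sched ∘ₖ metropolisSweep (sunMetropolisKick N s)
                (fun U : GaugeConfig d L (Matrix.specialUnitaryGroup (Fin N) ℂ) => Real.exp (-β * wilsonAction (suRep N) U)) nhit Ls)
              (wilsonMeasure (d := d) (L := L) (suRep N) β)
              (fun y => f y - ∫ z, f z ∂(wilsonMeasure (d := d) (L := L) (suRep N) β)) 0 ≠ 0)
    (hσ : 0 < ((∫ y, (f y - ∫ z, f z ∂(wilsonMeasure (d := d) (L := L) (suRep N) β)) ^ 2 ∂(wilsonMeasure (d := d) (L := L) (suRep N) β))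
          + 2 * ∑' k, ∫ y, (f y - ∫ z, f z ∂(wilsonMeasure (d := d) (L := L) (suRep N) β)) * (kop (cmORSweep sched ∘ₖ metropolisSweep (sunMetropolisKick N s)
                (fun U : GaugeConfig d L (Matrix.specialUnitaryGroup (Fin N) ℂ) => Real.exp (-β * wilsonAction (suRep N) U)) nhit Ls))^[k + 1]
              (fun y => f y - ∫ z, f z ∂(wilsonMeasure (d := d) (L := L) (suRep N) β)) y ∂(wilsonMeasure (d := d) (L := L) (suRep N) β)))
    (μ₀ : Measure (GaugeConfig d L (Matrix.specialUnitaryGroup (Fin N) ℂ))) [IsProbabilityMeasure μ₀] {a b : ℕ → ℕ}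
    (ha : Tendsto a atTop atTop) (hb : Tendsto b atTop atTop) (hab : Tendsto (fun n => (a n : ℝ) / (b n : ℝ) ^ 2) atTop (𝓝 0))
    [IsProbabilityMeasure (Kernel.trajMeasure (X := fun _ : ℕ => GaugeConfig d L (Matrix.specialUnitaryGroup (Fin N) ℂ)) μ₀
          (fun n : ℕ => (cmORSweep sched ∘ₖ metropolisSweep (sunMetropolisKick N s)
                (fun U : GaugeConfig d L (Matrix.specialUnitaryGroup (Fin N) ℂ) => Real.exp (-β * wilsonAction (suRep N) U)) nhit Ls).comap
              (fun h' : (i : ↥(Finset.Iic n))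
                → GaugeConfig d L (Matrix.specialUnitaryGroup (Fin N) ℂ) => h' ⟨n, Finset.mem_Iic.2 le_rfl⟩)
            (measurable_pi_apply _)))] (z : ℝ) :
    Tendsto (fun n : ℕ => ((Kernel.trajMeasure (X := fun _ : ℕ => GaugeConfig d L (Matrix.specialUnitaryGroup (Fin N) ℂ)) μ₀
          (fun n : ℕ => (cmORSweep sched ∘ₖ metropolisSweep (sunMetropolisKick N s)
                (fun U : GaugeConfig d L (Matrix.specialUnitaryGroup (Fin N) ℂ) => Real.exp (-β * wilsonAction (suRep N) U)) nhit Ls).comap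
              (fun h' : (i : ↥(Finset.Iic n))
                → GaugeConfig d L (Matrix.specialUnitaryGroup (Fin N) ℂ) => h' ⟨n, Finset.mem_Iic.2
                le_rfl⟩)
            (measurable_pi_apply _)))).real
      {x | |Real.sqrt (a n) * ((((b n * a n : ℕ) : ℝ) * replicaSEsq
              (fun j (x : ℕ → GaugeConfig d L (Matrix.specialUnitaryGroup (Fin N) ℂ)) => (∑ i ∈
            Finset.range (b n), f (x (b n * j + i))) / (b n)) (a n) x) / (2 * ((∑ t ∈ Finset.range
            (b n * a n), f (x t) ^ 2) / ((b n * a n : ℕ) : ℝ) - ((∑ t ∈ Finset.range (b n * a n), f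
            (x t)) / ((b n * a n : ℕ) : ℝ)) ^ 2))
          - tauInt (fun t => autocov (cmORSweep sched ∘ₖ metropolisSweep (sunMetropolisKick N s)
                (fun U : GaugeConfig d L (Matrix.specialUnitaryGroup (Fin N) ℂ) => Real.exp (-β * wilsonAction (suRep N) U)) nhit Ls)
              (wilsonMeasure (d := d) (L := L) (suRep N) β)
              (fun y => f y - ∫ z, f z ∂(wilsonMeasure (d := d) (L := L) (suRep N) β)) t
              / autocov (cmORSweep sched ∘ₖ metropolisSweep (sunMetropolisKick N s)
                (fun U : GaugeConfig d L (Matrix.specialUnitaryGroup (Fin N) ℂ) => Real.exp (-β * wilsonAction (suRep N) U)) nhit Ls)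
              (wilsonMeasure (d := d) (L := L) (suRep N) β)
              (fun y => f y - ∫ z, f z ∂(wilsonMeasure (d := d) (L := L) (suRep N) β)) 0))
        / (Real.sqrt 2 * ((((b n * a n : ℕ) : ℝ) * replicaSEsq
              (fun j (x : ℕ → GaugeConfig d L (Matrix.specialUnitaryGroup (Fin N) ℂ)) => (∑ i ∈
              Finset.range (b n), f (x (b n * j + i))) / (b n)) (a n) x) / (2 * ((∑ t ∈
              Finset.range (b n * a n), f (x t) ^ 2) / ((b n * a n : ℕ) : ℝ) - ((∑ t ∈ Finset.range
              (b n * a n), f (x t)) / ((b n * a n : ℕ) : ℝ)) ^ 2))))| ≤ z})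
      atTop (𝓝 ((gaussianReal 0 1).real (Set.Icc (-z) z))) := by
  haveI := isProbabilityMeasure_wilsonMeasure_suRep N (d := d) (L := L) β
  obtain ⟨hinv, mm, ε', hmm, hε0, hε1, hmin⟩ :=
    wilson_sunMetropolis_orSweep_certificate N s (d := d) hL β hn hLs sched
  obtain ⟨A, ρ, hA, hρ0, hρ1, henv⟩ := Scoring.exists_geometricEnvelope_of_nHit (GeneralNCMC.minorised_setwise hmin)
    hε0 hε1 hmm hinv
  have hY : HasLaw (fun t : ℝ => t) (gaussianReal 0 1) (gaussianReal 0 1) := ⟨aemeasurable_id', Measure.map_id'⟩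
  exact Scoring.CardConsistency.tendsto_measureReal_abs_le_gaussian
    (Scoring.chain_batchMeans_tauInt_studentized_clt_of_envelope hinv henv hA hρ0 hρ1 hf hC hvar hσ μ₀ ha hb hab hY) hY z

end MetroOR

/-! ## §5 CM `'hb' + n_or × 'or'` -/

section CMOR

variable (N : ℕ) [NeZero N] {d L : ℕ} {m : Type*} [Fintype m] [DecidableEq m]

/-- **THE SAME FOR `'hb' + n_or × 'or'`** (`L ≥ 2`, lexicographic subgroup order or its reverse, every link visited,
any OR schedule). -/
theorem wilson_cmSweep_orSweep_tauInt_interval_coverage [NeZero L] (hL : 2 ≤ L) (β : ℝ) (frames : List (Fin N ≃ Fin 2 ⊕ m))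
    (hlex : frames.map pairOf = lexPairs (Finset.univ.sort (· ≤ ·) : List (Fin N)) ∨
      frames.map pairOf = (lexPairs (Finset.univ.sort (· ≤ ·) : List (Fin N))).reverse)
    {links : List (Edge d L)} (hl : ∀ e, e ∈ links) (sched : List (Edge d L × (Fin N ≃ Fin 2 ⊕ m)))
    [IsMarkovKernel (latSweep (gibbsDensity fun U : GaugeConfig d L (Matrix.specialUnitaryGroup (Fin N) ℂ) => β * wilsonAction (suRep N) U) frames links)]
    {f : GaugeConfig d L (Matrix.specialUnitaryGroup (Fin N) ℂ) → ℝ} (hf : Measurable f) {C : ℝ} (hC : ∀ U, |f U| ≤ C)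
    (hvar : autocov (cmORSweep sched ∘ₖ
                latSweep (gibbsDensity fun U : GaugeConfig d L (Matrix.specialUnitaryGroup (Fin N) ℂ) => β * wilsonAction (suRep N) U) frames links)
              (wilsonMeasure (d := d) (L := L) (suRep N) β)
              (fun y => f y - ∫ z, f z ∂(wilsonMeasure (d := d) (L := L) (suRep N) β)) 0 ≠ 0)
    (hσ : 0 < ((∫ y, (f y - ∫ z, f z ∂(wilsonMeasure (d := d) (L := L) (suRep N) β)) ^ 2 ∂(wilsonMeasure (d := d) (L := L) (suRep N) β))
          + 2 * ∑' k, ∫ y, (f y - ∫ z, f z ∂(wilsonMeasure (d := d) (L := L) (suRep N) β)) * (kop (cmORSweep sched ∘ₖ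
                latSweep (gibbsDensity fun U : GaugeConfig d L (Matrix.specialUnitaryGroup (Fin N) ℂ) => β * wilsonAction (suRep N) U) frames links))^[k + 1]
              (fun y => f y - ∫ z, f z ∂(wilsonMeasure (d := d) (L := L) (suRep N) β)) y ∂(wilsonMeasure (d := d) (L := L) (suRep N) β)))
    (μ₀ : Measure (GaugeConfig d L (Matrix.specialUnitaryGroup (Fin N) ℂ))) [IsProbabilityMeasure μ₀] {a b : ℕ → ℕ}
    (ha : Tendsto a atTop atTop) (hb : Tendsto b atTop atTop) (hab : Tendsto (fun n => (a n : ℝ) / (b n : ℝ) ^ 2) atTop (𝓝 0))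
    [IsProbabilityMeasure (Kernel.trajMeasure (X := fun _ : ℕ => GaugeConfig d L (Matrix.specialUnitaryGroup (Fin N) ℂ)) μ₀
          (fun n : ℕ => (cmORSweep sched ∘ₖ
                latSweep (gibbsDensity fun U : GaugeConfig d L (Matrix.specialUnitaryGroup (Fin N) ℂ) => β * wilsonAction (suRep N) U) frames links).comap
              (fun h' : (i : ↥(Finset.Iic n))
                → GaugeConfig d L (Matrix.specialUnitaryGroup (Fin N) ℂ) => h' ⟨n, Finset.mem_Iic.2 le_rfl⟩)
            (measurable_pi_apply _)))] (z : ℝ) :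
    Tendsto (fun n : ℕ => ((Kernel.trajMeasure (X := fun _ : ℕ => GaugeConfig d L (Matrix.specialUnitaryGroup (Fin N) ℂ)) μ₀
          (fun n : ℕ => (cmORSweep sched ∘ₖ
                latSweep (gibbsDensity fun U : GaugeConfig d L (Matrix.specialUnitaryGroup (Fin N) ℂ) => β * wilsonAction (suRep N) U) frames links).comap
              (fun h' : (i : ↥(Finset.Iic n))
                → GaugeConfig d L (Matrix.specialUnitaryGroup (Fin N) ℂ) => h' ⟨n, Finset.mem_Iic.2
                le_rfl⟩)
            (measurable_pi_apply _)))).real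
      {x | |Real.sqrt (a n) * ((((b n * a n : ℕ) : ℝ) * replicaSEsq
              (fun j (x : ℕ → GaugeConfig d L (Matrix.specialUnitaryGroup (Fin N) ℂ)) => (∑ i ∈
            Finset.range (b n), f (x (b n * j + i))) / (b n)) (a n) x) / (2 * ((∑ t ∈ Finset.range
            (b n * a n), f (x t) ^ 2) / ((b n * a n : ℕ) : ℝ) - ((∑ t ∈ Finset.range (b n * a n), f
            (x t)) / ((b n * a n : ℕ) : ℝ)) ^ 2))
          - tauInt (fun t => autocov (cmORSweep sched ∘ₖ
                latSweep (gibbsDensity fun U : GaugeConfig d L (Matrix.specialUnitaryGroup (Fin N) ℂ) => β * wilsonAction (suRep N) U) frames links)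
              (wilsonMeasure (d := d) (L := L) (suRep N) β)
              (fun y => f y - ∫ z, f z ∂(wilsonMeasure (d := d) (L := L) (suRep N) β)) t
              / autocov (cmORSweep sched ∘ₖ
                latSweep (gibbsDensity fun U : GaugeConfig d L (Matrix.specialUnitaryGroup (Fin N) ℂ) => β * wilsonAction (suRep N) U) frames links)
              (wilsonMeasure (d := d) (L := L) (suRep N) β)
              (fun y => f y - ∫ z, f z ∂(wilsonMeasure (d := d) (L := L) (suRep N) β)) 0))
        / (Real.sqrt 2 * ((((b n * a n : ℕ) : ℝ) * replicaSEsq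
              (fun j (x : ℕ → GaugeConfig d L (Matrix.specialUnitaryGroup (Fin N) ℂ)) => (∑ i ∈
              Finset.range (b n), f (x (b n * j + i))) / (b n)) (a n) x) / (2 * ((∑ t ∈
              Finset.range (b n * a n), f (x t) ^ 2) / ((b n * a n : ℕ) : ℝ) - ((∑ t ∈ Finset.range
              (b n * a n), f (x t)) / ((b n * a n : ℕ) : ℝ)) ^ 2))))| ≤ z})
      atTop (𝓝 ((gaussianReal 0 1).real (Set.Icc (-z) z))) := by
  haveI : IsProbabilityMeasure (wilsonMeasure (d := d) (L := L) (suRep N) β) := isProbabilityMeasure_wilsonMeasure _ continuous_suRep β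
  obtain ⟨hinv, ε', hε0, hε1, hmin⟩ := wilson_cmSweep_orSweep_certificate N (d := d) hL β frames hlex hl sched
  obtain ⟨A, ρ, hA, hρ0, hρ1, henv⟩ := Scoring.exists_geometricEnvelope_of_nHit (GeneralNCMC.minorised_setwise hmin)
    hε0 hε1 Nat.one_pos hinv
  have hY : HasLaw (fun t : ℝ => t) (gaussianReal 0 1) (gaussianReal 0 1) := ⟨aemeasurable_id', Measure.map_id'⟩
  exact Scoring.CardConsistency.tendsto_measureReal_abs_le_gaussian
    (Scoring.chain_batchMeans_tauInt_studentized_clt_of_envelope hinv henv hA hρ0 hρ1 hf hC hvar hσ μ₀ ha hb hab hY) hY z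

end CMOR

end Summit.Ventures.LatticeQCDFlow.Exactness

end
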